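import Summits.AtomisticToContinuum.FouriersLaw.Theorems.VanishingNoiseTransferVanishingNoiseBoundFlipSteadyStateBind

/-!
# Exponential moments of THE unique weak flip steady state, for every flip rate
(brick for crux stmt-AtomisticToContinuum-11976 `VanishingNoiseTransfer.VanishingNoiseBound`, line
`fekete-usc-one-length`, stub S3 `stub_noisyPositiveConductance`; worker file, wave 2)

The frame of stub S3 hands over, at a fixed flip rate `ε > 0`, THE unique weak flip steady state
`μ` of `L + εS` (`OscillatorChain.IsFlipSteadyState`) of the pinned anharmonic chain
`pinnedChain ω₂ lam β γ` at every `(N, T_L, T_R)`, and nothing else: the predicate only says that `μ` is a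
probability measure solving `∫ (L + εS) f dμ = 0` on `C_c^∞` with integrable bond currents. Every step
towards the finite-volume Green–Kubo formula for `L + εS` (the residual content of S3) tests the weak
equation against observables that are NOT compactly supported (block energies, currents, the corrector),
which needs moments. This file supplies them, for EVERY rate `ε > 0` and all `N`:

* `eq_bind_resolvent_of_unique` (`N ≥ 2`): by uniqueness, `μ` IS the embedded-chain steady state
  `π R` of `VelocityFlipSteadyStateExists.lean` / `…FlipSteadyStateBind.lean` — `R = R_{Nε}` the resolvent
  kernel of the flip-free transition semigroup (resolvent identity, Feller, contracting Lyapunov bound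
  `R e^{θH} ≤ a e^{θH} + b`, `a < 1`), `π = π (Q ∘ₖ R)` an invariant law of the chain embedded at the flip
  times with `∫ e^{θH} dπ ≤ b/(1-a)` — for EVERY `0 < θ < 1/max(T_L,T_R)`;
* `lintegral_exp_le_of_unique`, `integrable_exp_of_unique` (all `N`; `N = 0`: one point; `N = 1`: `μ` is
  the Gibbs measure at the mean temperature): `∫ e^{θH} dμ ≤ a b/(1-a) + b < ∞`, so `e^{θH} ∈ L¹(μ)` for all
  `0 < θ < 1/max(T_L,T_R)` — the integrability range of CEHR 2018 Thm 2.13 (2) for the flip-free chain;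
* `integrable_of_abs_le_exp_of_unique`: hence every continuous observable dominated by `C e^{θH}` (all
  polynomials in `(q, p)`) is `μ`-integrable;
* `helper_flipFamilyExpIntegrable` — the registered sub-goal: the same in the frame of S3 (a flip-steady
  and unique family `μ N T_L T_R` at rate `ε > 0`).

No definitions. References: Bernardin–Olla 2011 (J. Stat. Phys. 145), §2.1 and Prop. 1 (the flip chain and
its stationary state); Cuneo–Eckmann–Hairer–Rey-Bellet 2018 (EJP 23), Thm 2.13 (2) and Thm 5.1 (the
Lyapunov function `e^{θH}`, `0 < θ < 1/T_max`).
-/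

noncomputable section

namespace Summit.AtomisticToContinuum.FouriersLaw.Theorems.VanishingNoiseBound

open MeasureTheory ProbabilityTheory Filter Topology
open scoped NNReal ENNReal ContDiff BoundedContinuousFunction
open Literature.MathematicalPhysics.KineticTheory.HeatConduction

section Moments

variable {ω₂ lam β γ : ℝ}

/-- **The unique weak flip steady state is the embedded-chain steady state `π R`** (`N ≥ 2`, all
parameters `> 0`, rate `ε > 0`, any `0 < θ < 1/max(T_L,T_R)`): there are a Markov kernel `R` with the
resolvent identity `∫ Lf dR(z,·) = Nε (∫ f dR(z,·) - f z)` on `C_c^∞`, the Feller property and the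
contracting Lyapunov bound `∫ e^{θH} dR(z,·) ≤ a e^{θH(z)} + b` (`a < 1`, `b < ∞`), and a probability measure
`π` with `∫ e^{θH} dπ ≤ b/(1-a)`, such that `μ = π.bind R`. (Existence: `pinnedChain_exists_resolventKernel` and
`exists_isFlipSteadyState_bind_of_resolventKernel`; identification: the uniqueness clause.)
[Bernardin–Olla 2011, Prop. 1] [folklore] -/
theorem eq_bind_resolvent_of_unique (hω : 0 < ω₂) (hl : 0 < lam) (hβ : 0 < β) (hγ : 0 < γ) {N : ℕ}
    (hN : 1 < N) {T_L T_R ε : ℝ} (hL : 0 < T_L) (hR : 0 < T_R) (hε : 0 < ε)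
    {μ : Measure (PhaseSpace N)}
    (hμ : (pinnedChain ω₂ lam β γ).IsFlipSteadyState N T_L T_R ε μ ∧
      ∀ ν : Measure (PhaseSpace N), (pinnedChain ω₂ lam β γ).IsFlipSteadyState N T_L T_R ε ν → ν = μ)
    {θ : ℝ} (hθ : 0 < θ) (hθ' : θ < 1 / max T_L T_R) :
    ∃ R : Kernel (PhaseSpace N) (PhaseSpace N), IsMarkovKernel R ∧
      (∀ f : PhaseSpace N → ℝ, ContDiff ℝ ∞ f → HasCompactSupport f → ∀ z : PhaseSpace N,
        ∫ y, (pinnedChain ω₂ lam β γ).generator N T_L T_R f y ∂(R z) =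
          (N * ε) * (∫ y, f y ∂(R z) - f z)) ∧
      (∀ g : PhaseSpace N →ᵇ ℝ, Continuous fun z => ∫ y, g y ∂(R z)) ∧
      ∃ a b : ℝ≥0∞, a < 1 ∧ b ≠ ⊤ ∧
        (∀ z : PhaseSpace N,
          ∫⁻ y, ENNReal.ofReal (Real.exp (θ * (pinnedChain ω₂ lam β γ).hamiltonian N y)) ∂(R z) ≤
            a * ENNReal.ofReal (Real.exp (θ * (pinnedChain ω₂ lam β γ).hamiltonian N z)) + b) ∧
        ∃ π : Measure (PhaseSpace N), IsProbabilityMeasure π ∧ μ = π.bind R ∧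
          ∫⁻ y, ENNReal.ofReal (Real.exp (θ * (pinnedChain ω₂ lam β γ).hamiltonian N y)) ∂π ≤
            b / (1 - a) := by
  have hN0 : 0 < N := by omega
  have hr : (0 : ℝ) < (N : ℝ) * ε := by positivity
  obtain ⟨R, hRm, hres, hfel, a, b, ha, hb, hly⟩ :=
    pinnedChain_exists_resolventKernel hω hl hβ hγ hN hL hR hr hθ hθ'
  haveI := hRm
  obtain ⟨π, hπ, hsteady, hπV⟩ :=
    FixedLengthNoiseContinuity.exists_isFlipSteadyState_bind_of_resolventKernel hω hl.le hβ.le hN0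
      T_L T_R ε R hres hfel hθ ha hb hly
  exact ⟨R, hRm, hres, hfel, a, b, ha, hb, hly, π, hπ, (hμ.2 _ hsteady).symm ▸ rfl, hπV⟩

/-- **Quantitative exponential moment of the unique weak flip steady state** (`N ≥ 2`): with the
constants `a < 1`, `b < ∞` of the resolvent kernel at rate `Nε`, `∫ e^{θH} dμ ≤ a · b/(1-a) + b`
(`μ = π R`, `R e^{θH} ≤ a e^{θH} + b`, `∫ e^{θH} dπ ≤ b/(1-a)`). [folklore] -/
theorem lintegral_exp_le_of_unique (hω : 0 < ω₂) (hl : 0 < lam) (hβ : 0 < β) (hγ : 0 < γ) {N : ℕ}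
    (hN : 1 < N) {T_L T_R ε : ℝ} (hL : 0 < T_L) (hR : 0 < T_R) (hε : 0 < ε)
    {μ : Measure (PhaseSpace N)}
    (hμ : (pinnedChain ω₂ lam β γ).IsFlipSteadyState N T_L T_R ε μ ∧
      ∀ ν : Measure (PhaseSpace N), (pinnedChain ω₂ lam β γ).IsFlipSteadyState N T_L T_R ε ν → ν = μ)
    {θ : ℝ} (hθ : 0 < θ) (hθ' : θ < 1 / max T_L T_R) :
    ∃ a b : ℝ≥0∞, a < 1 ∧ b ≠ ⊤ ∧
      ∫⁻ y, ENNReal.ofReal (Real.exp (θ * (pinnedChain ω₂ lam β γ).hamiltonian N y)) ∂μ ≤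
        a * (b / (1 - a)) + b := by
  obtain ⟨R, hRm, -, -, a, b, ha, hb, hly, π, hπ, rfl, hπV⟩ :=
    eq_bind_resolvent_of_unique hω hl hβ hγ hN hL hR hε hμ hθ hθ'
  have hVmeas : Measurable fun y : PhaseSpace N =>
      ENNReal.ofReal (Real.exp (θ * (pinnedChain ω₂ lam β γ).hamiltonian N y)) :=
    ENNReal.measurable_ofReal.comp (Real.measurable_exp.comp
      ((pinnedChain_continuous_hamiltonian ω₂ lam β γ N).measurable.const_mul _))
  refine ⟨a, b, ha, hb, ?_⟩
  calc ∫⁻ y, ENNReal.ofReal (Real.exp (θ * (pinnedChain ω₂ lam β γ).hamiltonian N y)) ∂(π.bind R)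
      ≤ a * ∫⁻ x, ENNReal.ofReal (Real.exp (θ * (pinnedChain ω₂ lam β γ).hamiltonian N x)) ∂π +
          b * π Set.univ :=
        Literature.Probability.Process.MarkovChain.lintegral_bind_le_of_lyapunov R hVmeas hly π
    _ ≤ a * (b / (1 - a)) + b := by
        rw [measure_univ, mul_one]
        gcongr

/-- **`e^{θH} ∈ L¹` of the unique weak flip steady state, every rate, every `N`** (parameters `> 0`,
`T_L, T_R > 0`, `ε > 0`, `0 < θ < 1/max(T_L,T_R)`): for `N ≥ 2` by `lintegral_exp_le_of_unique`; for `N = 1`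
the unique flip steady state is the Gibbs measure at the mean temperature `(T_L+T_R)/2 ≤ max(T_L,T_R)`
(`pinnedChain_isFlipSteadyState_gibbsMeasure_one`); for `N = 0` phase space is one point. This is the
integrability range of Cuneo–Eckmann–Hairer–Rey-Bellet 2018, Thm 2.13 (2), now for the flip-noisy chain.
[Bernardin–Olla 2011, Prop. 1; Cuneo–Eckmann–Hairer–Rey-Bellet 2018, Thm 2.13 (2)] [folklore] -/
theorem integrable_exp_of_unique (hω : 0 < ω₂) (hl : 0 < lam) (hβ : 0 < β) (hγ : 0 < γ) {N : ℕ}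
    {T_L T_R ε : ℝ} (hL : 0 < T_L) (hR : 0 < T_R) (hε : 0 < ε)
    {μ : Measure (PhaseSpace N)}
    (hμ : (pinnedChain ω₂ lam β γ).IsFlipSteadyState N T_L T_R ε μ ∧
      ∀ ν : Measure (PhaseSpace N), (pinnedChain ω₂ lam β γ).IsFlipSteadyState N T_L T_R ε ν → ν = μ)
    {θ : ℝ} (hθ : 0 < θ) (hθ' : θ < 1 / max T_L T_R) :
    Integrable (fun z => Real.exp (θ * (pinnedChain ω₂ lam β γ).hamiltonian N z)) μ := by
  haveI : IsProbabilityMeasure μ := hμ.1.isProbabilityMeasure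
  have hcont : Continuous fun z : PhaseSpace N =>
      Real.exp (θ * (pinnedChain ω₂ lam β γ).hamiltonian N z) :=
    Real.continuous_exp.comp (continuous_const.mul (pinnedChain_continuous_hamiltonian ω₂ lam β γ N))
  rcases Nat.lt_or_ge N 2 with hN | hN
  · interval_cases N
    · -- `N = 0`: one-point phase space
      exact Integrable.of_finite
    · -- `N = 1`: the Gibbs measure at the mean temperature
      have hT : 0 < (T_L + T_R) / 2 := by positivity
      have hgibbs := hμ.2 _ (pinnedChain_isFlipSteadyState_gibbsMeasure_one hω hl.le hβ.le γ hL hR ε)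
      rw [← hgibbs]
      refine pinnedChain_integrable_exp_mul_hamiltonian_gibbsMeasure hω hl.le hβ.le γ 1 hT
        (lt_of_lt_of_le hθ' ?_)
      have hmax : (T_L + T_R) / 2 ≤ max T_L T_R := by
        have h1 := le_max_left T_L T_R
        have h2 := le_max_right T_L T_R
        linarith
      exact one_div_le_one_div_of_le hT hmax
  · obtain ⟨a, b, ha, hb, hle⟩ := lintegral_exp_le_of_unique hω hl hβ hγ hN hL hR hε hμ hθ hθ'
    refine ⟨hcont.aestronglyMeasurable, ?_⟩
    show ∫⁻ x, ‖Real.exp (θ * (pinnedChain ω₂ lam β γ).hamiltonian N x)‖ₑ ∂μ < ⊤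
    simp only [Real.enorm_eq_ofReal (Real.exp_nonneg _)]
    refine hle.trans_lt (ENNReal.add_lt_top.2 ⟨ENNReal.mul_lt_top (ha.trans_le le_top) ?_, hb.lt_top⟩)
    exact ENNReal.div_lt_top hb (tsub_pos_of_lt ha).ne'

/-- **Every `e^{θH}`-dominated continuous observable is integrable under the unique weak flip steady
state** (e.g. all polynomials in `(q, p)`: kinetic temperatures, block energies, currents and their
products). [folklore] -/
theorem integrable_of_abs_le_exp_of_unique (hω : 0 < ω₂) (hl : 0 < lam) (hβ : 0 < β) (hγ : 0 < γ)
    {N : ℕ} {T_L T_R ε : ℝ} (hL : 0 < T_L) (hR : 0 < T_R) (hε : 0 < ε)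
    {μ : Measure (PhaseSpace N)}
    (hμ : (pinnedChain ω₂ lam β γ).IsFlipSteadyState N T_L T_R ε μ ∧
      ∀ ν : Measure (PhaseSpace N), (pinnedChain ω₂ lam β γ).IsFlipSteadyState N T_L T_R ε ν → ν = μ)
    {θ : ℝ} (hθ : 0 < θ) (hθ' : θ < 1 / max T_L T_R) {g : PhaseSpace N → ℝ} (hg : Continuous g)
    {C : ℝ} (hC : ∀ z, |g z| ≤ C * Real.exp (θ * (pinnedChain ω₂ lam β γ).hamiltonian N z)) :
    Integrable g μ :=
  ((integrable_exp_of_unique hω hl hβ hγ hL hR hε hμ hθ hθ').const_mul C).mono'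
    hg.aestronglyMeasurable (Eventually.of_forall fun z => by
      simpa only [Real.norm_eq_abs] using hC z)

/-- `H^k ≤ k! θ^{-k} e^{θH}` for `H ≥ 0`, `θ > 0` (from `x^k/k! ≤ e^x`). [folklore] -/
theorem pow_le_factorial_div_mul_exp {H θ : ℝ} (hH : 0 ≤ H) (hθ : 0 < θ) (k : ℕ) :
    H ^ k ≤ (k.factorial : ℝ) / θ ^ k * Real.exp (θ * H) := by
  have h := Real.pow_div_factorial_le_exp (θ * H) (by positivity) k
  have hk : (0 : ℝ) < k.factorial := by exact_mod_cast k.factorial_pos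
  have hθk : 0 < θ ^ k := pow_pos hθ k
  rw [mul_pow, div_le_iff₀ hk] at h
  rw [div_mul_eq_mul_div, le_div_iff₀ hθk]
  nlinarith [h]

/-- **Polynomial moments of the energy**: `H^k ∈ L¹` of the unique weak flip steady state, every `k`
(`H^k ≤ k! θ^{-k} e^{θH}` with `θ = 1/(2 max(T_L,T_R))`). Since `p_i² ≤ 2H`, `ω₂ q_i² ≤ 2H` and
`|j_i| ≤ C (1 + H)²`, all polynomial observables of the chain follow. [folklore] -/
theorem integrable_hamiltonian_pow_of_unique (hω : 0 < ω₂) (hl : 0 < lam) (hβ : 0 < β) (hγ : 0 < γ)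
    {N : ℕ} {T_L T_R ε : ℝ} (hL : 0 < T_L) (hR : 0 < T_R) (hε : 0 < ε)
    {μ : Measure (PhaseSpace N)}
    (hμ : (pinnedChain ω₂ lam β γ).IsFlipSteadyState N T_L T_R ε μ ∧
      ∀ ν : Measure (PhaseSpace N), (pinnedChain ω₂ lam β γ).IsFlipSteadyState N T_L T_R ε ν → ν = μ)
    (k : ℕ) :
    Integrable (fun z => (pinnedChain ω₂ lam β γ).hamiltonian N z ^ k) μ := by
  have hmax : 0 < max T_L T_R := lt_max_of_lt_left hL
  set θ : ℝ := 1 / max T_L T_R / 2 with hθdef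
  have hθ : 0 < θ := by positivity
  have hθ' : θ < 1 / max T_L T_R := half_lt_self (by positivity)
  refine integrable_of_abs_le_exp_of_unique hω hl hβ hγ hL hR hε hμ hθ hθ'
    ((pinnedChain_continuous_hamiltonian ω₂ lam β γ N).pow k) (C := (k.factorial : ℝ) / θ ^ k)
    fun z => ?_
  have hH := pinnedChain_hamiltonian_nonneg hω.le hl.le hβ.le γ N z
  rw [abs_of_nonneg (pow_nonneg hH k)]
  exact pow_le_factorial_div_mul_exp hH hθ k

/-- **Polynomially bounded observables are integrable** under the unique weak flip steady state:
a continuous `g` with `|g| ≤ C (1 + H^k)` is in `L¹(μ)`. [folklore] -/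
theorem integrable_of_abs_le_hamiltonian_pow_of_unique (hω : 0 < ω₂) (hl : 0 < lam) (hβ : 0 < β)
    (hγ : 0 < γ) {N : ℕ} {T_L T_R ε : ℝ} (hL : 0 < T_L) (hR : 0 < T_R) (hε : 0 < ε)
    {μ : Measure (PhaseSpace N)}
    (hμ : (pinnedChain ω₂ lam β γ).IsFlipSteadyState N T_L T_R ε μ ∧
      ∀ ν : Measure (PhaseSpace N), (pinnedChain ω₂ lam β γ).IsFlipSteadyState N T_L T_R ε ν → ν = μ)
    {g : PhaseSpace N → ℝ} (hg : Continuous g) {C : ℝ} {k : ℕ}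
    (hC : ∀ z, |g z| ≤ C * (1 + (pinnedChain ω₂ lam β γ).hamiltonian N z ^ k)) :
    Integrable g μ := by
  haveI : IsProbabilityMeasure μ := hμ.1.isProbabilityMeasure
  have h1 : Integrable (fun z => C * (1 + (pinnedChain ω₂ lam β γ).hamiltonian N z ^ k)) μ :=
    ((integrable_const 1).add (integrable_hamiltonian_pow_of_unique hω hl hβ hγ hL hR hε hμ k)).const_mul C
  exact h1.mono' hg.aestronglyMeasurable (Eventually.of_forall fun z => by
    simpa only [Real.norm_eq_abs] using hC z)

/-- **Kinetic temperatures have all moments**: `p_i^{2k} ∈ L¹(μ)` (`p_i² ≤ 2H`). [folklore] -/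
theorem integrable_momentum_pow_of_unique (hω : 0 < ω₂) (hl : 0 < lam) (hβ : 0 < β) (hγ : 0 < γ)
    {N : ℕ} {T_L T_R ε : ℝ} (hL : 0 < T_L) (hR : 0 < T_R) (hε : 0 < ε)
    {μ : Measure (PhaseSpace N)}
    (hμ : (pinnedChain ω₂ lam β γ).IsFlipSteadyState N T_L T_R ε μ ∧
      ∀ ν : Measure (PhaseSpace N), (pinnedChain ω₂ lam β γ).IsFlipSteadyState N T_L T_R ε ν → ν = μ)
    (i : Fin N) (k : ℕ) :
    Integrable (fun z : PhaseSpace N => (z.2 i ^ 2) ^ k) μ := by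
  refine integrable_of_abs_le_hamiltonian_pow_of_unique hω hl hβ hγ hL hR hε hμ (by fun_prop)
    (C := 2 ^ k) (k := k) fun z => ?_
  have hH := pinnedChain_hamiltonian_nonneg hω.le hl.le hβ.le γ N z
  have hp : z.2 i ^ 2 / 2 ≤ (pinnedChain ω₂ lam β γ).hamiltonian N z := by
    have h := pinnedChain_harmonic_le_hamiltonian (ω₂ := ω₂) hl.le hβ.le γ N z
    have h1 : z.2 i ^ 2 / 2 ≤ ∑ j, z.2 j ^ 2 / 2 :=
      Finset.single_le_sum (f := fun j => z.2 j ^ 2 / 2) (fun j _ => by positivity)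
        (Finset.mem_univ i)
    have h2 : 0 ≤ ∑ j, ω₂ * z.1 j ^ 2 / 2 := Finset.sum_nonneg fun j _ => by positivity
    linarith
  have hp' : z.2 i ^ 2 ≤ 2 * (pinnedChain ω₂ lam β γ).hamiltonian N z := by linarith
  rw [abs_of_nonneg (by positivity)]
  calc (z.2 i ^ 2) ^ k ≤ (2 * (pinnedChain ω₂ lam β γ).hamiltonian N z) ^ k :=
        pow_le_pow_left₀ (by positivity) hp' k
    _ = 2 ^ k * (pinnedChain ω₂ lam β γ).hamiltonian N z ^ k := by rw [mul_pow]
    _ ≤ 2 ^ k * (1 + (pinnedChain ω₂ lam β γ).hamiltonian N z ^ k) := by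
        gcongr; linarith [pow_nonneg hH k]

/-- **Registered sub-goal `helper_flipFamilyExpIntegrable`** of stmt-AtomisticToContinuum-11976 (brick for
stub S3 `stub_noisyPositiveConductance`): in the frame of S3 — a family `μ N T_L T_R` that is, for all `N`
and all `T_L, T_R > 0`, THE unique weak flip steady state of `L + εS` at a rate `ε > 0` — every member
integrates `e^{θH}` for all `0 < θ < 1/max(T_L,T_R)` (notation-free one-line form of
`integrable_exp_of_unique`). [Cuneo–Eckmann–Hairer–Rey-Bellet 2018, Thm 2.13 (2)] [folklore] -/
theorem helper_flipFamilyExpIntegrable : ∀ (ω₂ lam β γ : ℝ), 0 < ω₂ → 0 < lam → 0 < β → 0 < γ → ∀ (ε : ℝ), 0 < ε → ∀ μ : (N : ℕ) → ℝ → ℝ → MeasureTheory.Measure (Literature.MathematicalPhysics.KineticTheory.HeatConduction.PhaseSpace N), (∀ (N : ℕ) (T_L T_R : ℝ), 0 < T_L → 0 < T_R → (Literature.MathematicalPhysics.KineticTheory.HeatConduction.pinnedChain ω₂ lam β γ).IsFlipSteadyState N T_L T_R ε (μ N T_L T_R) ∧ ∀ ν : MeasureTheory.Measure (Literature.MathematicalPhysics.KineticTheory.HeatConduction.PhaseSpace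 N), (Literature.MathematicalPhysics.KineticTheory.HeatConduction.pinnedChain ω₂ lam β γ).IsFlipSteadyState N T_L T_R ε ν → ν = μ N T_L T_R) → ∀ (N : ℕ) (T_L T_R : ℝ), 0 < T_L → 0 < T_R → ∀ θ : ℝ, 0 < θ → θ < 1 / max T_L T_R → MeasureTheory.Integrable (fun z : Literature.MathematicalPhysics.KineticTheory.HeatConduction.PhaseSpace N => Real.exp (θ * (Literature.MathematicalPhysics.KineticTheory.HeatConduction.pinnedChain ω₂ lam β γ).hamiltonian N z)) (μ N T_L T_R) :=
  fun _ _ _ _ hω hl hβ hγ _ hε _ hμ N T_L T_R hL hR _ hθ hθ' =>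
    integrable_exp_of_unique hω hl hβ hγ hL hR hε (hμ N T_L T_R hL hR) hθ hθ'

end Moments

end Summit.AtomisticToContinuum.FouriersLaw.Theorems.VanishingNoiseBound

end
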